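import Mathlib
import HarnessLib
import Summits.NavierStokesRegularity.FluidComputer.TriggeredTransferH1
import Summits.NavierStokesRegularity.FluidComputer.TriggeredTransferCascadeWitness

/-!
# Door N1-FC v2 CLOSES ON (C): an `H¹` scheme that transfers has a cascade, hence an exact forced
# blow-up and Fefferman's breakdown statement — with NO named fact (analysis half v2, the closer)

Cell `ns-blowup`, seat `ns-blowup-fc-prover-1` (g5; D-0074 GROUP C «bridge support», door N1-FC).
Joins the door v2 TYPING `TriggerSchemeH1` (`TriggeredTransferH1.lean`, seat `ns-blowup-fc-prover-2`
g5, filed from the line owner's RULING ns-blowup STATUS l.3869: `H¹` alphabet above ignition, rapidly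
decaying IGNITION datum `seed`) to the ALPHABET-FREE cascade gluing of this seat
(`TriggeredTransferCascade.lean` … `TriggeredTransferCascadeWitness.lean`:
`navierStokesBreakdownR3_of_cascade : 0 < ν → Nonempty (𝒮.Cascade ν) → NavierStokesBreakdownR3`).
LABEL: E–C; the analysis half of door N1-FC v2. WHAT THIS IS NOT: not Navier–Stokes evidence — an
IMPLICATION from the OPEN predicate `TriggerSchemeH1.Transfers ν` (the physics «η > 1/λ uniformly in
Re», asserted NOWHERE in the tree); no scheme instance, no cascade and no blow-up is claimed; the
MODEL words of PREREG-FC-TRIG-1 and -2 are numerical-witness hypotheses, never this predicate.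

This is the line owner's «DEFERRED port» (RULING (4): generalise the g2 chain Run → … → Witness,
≈ 2 kLoC, to the `H¹` door) done WITHOUT porting anything to `TriggerSchemeH1`: the chain was re-run
ONCE over the alphabet-free `TriggerScheme.Cascade` (level-`0` state Clay, later states `H¹`), and an
`H¹` scheme feeds it through

* `TriggerSchemeH1.core : TriggerScheme` — **the ignition core**: the same constants with the CLAY
  SUB-ALPHABET `{w ∈ F U | HasRapidSpatialDecay w}` (a v1 scheme: Clay by `regular` + the decay clause,
  floors inherited, inhabited by `seed`); `core.Cascade ν` is then the cascade type with the scheme's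
  constants (`growth`, `seedAt`, `mag`, `ballRadius` are the core's);
* `TriggerSchemeH1.Link.toPiece` — a v2 link (hand-over into the `H¹` alphabet) is a `core`-piece;
* **`TriggerSchemeH1.nonempty_cascade : 0 < ν → 𝒮.Transfers ν → Nonempty (𝒮.core.Cascade ν)`** —
  dependent choice from the Clay ignition member through the `H¹` alphabet (`regular` supplies
  smoothness / incompressibility / `H¹`, `floor` the speed floors, `seed` the level-`0` decay);
* **`TriggerSchemeH1.nonempty_breakdownWitness : 0 < ν → 𝒮.Transfers ν → Nonempty (BreakdownWitness ν)`**
  and **`TriggerSchemeH1.navierStokesBreakdownR3_of_transfers : 0 < ν → 𝒮.Transfers ν →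
  NavierStokesBreakdownR3`** — ZERO named facts; the `TransfersB` and `∃`-forms follow
  (`…_of_transfersB`, `…_of_exists_transfers`, `…_of_exists_transfersB`).

So the door of record that closes (C) may now be v2 itself: `(∃ 𝒮 : TriggerSchemeH1, 𝒮.Transfers 1)
→ NavierStokesBreakdownR3`, unconditionally in the analysis, the physics being the only hypothesis.

References: T. Tao, J. Amer. Math. Soc. 29 (2016) 601–674, §1.3 [cite: Tao2016AveragedNS, §1.3];
C. L. Fefferman, Clay problem description, (A)(4), (C) [cite: FeffermanClay2006, (C)]; T. Tao,
Anal. PDE 6 (2013), Cor. 11.4 [cite: Tao2011, Cor. 11.4]. 0 sorry; axioms ⊆ {propext, Classical.choice, Quot.sound}.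
-/

noncomputable section

namespace Summit.NavierStokesRegularity.FluidComputer.TriggeredTransfer.TriggerSchemeH1

open Set Filter Function MeasureTheory
open scoped Topology ENNReal ContDiff
open Literature.Analysis.FluidPDE
open Literature.Analysis.FluidPDE.FluidComputer (E3 Vel)
open Summit.NavierStokesRegularity.FluidComputer.PalasekTowerClayBridge (BreakdownWitness)

variable (𝒮 : TriggerSchemeH1)

/-! ## The ignition core of an `H¹` scheme -/

/-- **The ignition core of an `H¹` scheme**: the v1 scheme with the same constants whose alphabet is
the CLAY SUB-ALPHABET `{w ∈ F U | w decays rapidly}` of the working alphabet — Clay by `regular` and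
the decay clause, speed floors inherited, inhabited above threshold by `seed`. It carries the
constants bookkeeping (`growth`, `seedAt`, `mag`, `ballRadius`, …) and the cascade type
`core.Cascade ν` for the scheme. [folklore] -/
def core : TriggerScheme where
  lam := 𝒮.lam
  eta := 𝒮.eta
  UStar := 𝒮.UStar
  F U := {w | w ∈ 𝒮.F U ∧ HasRapidSpatialDecay w}
  R := 𝒮.R
  c := 𝒮.c
  D := 𝒮.D
  A := 𝒮.A
  a := 𝒮.a
  Cτ := 𝒮.Cτ
  q := 𝒮.q
  one_lt_lam := 𝒮.one_lt_lam
  kelvin := 𝒮.kelvin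
  eta_le_one := 𝒮.eta_le_one
  UStar_pos := 𝒮.UStar_pos
  R_pos := 𝒮.R_pos
  c_pos := 𝒮.c_pos
  D_nonneg := 𝒮.D_nonneg
  A_nonneg := 𝒮.A_nonneg
  a_pos := 𝒮.a_pos
  Cτ_pos := 𝒮.Cτ_pos
  clay U hU w hw := ⟨(𝒮.regular U hU w hw.1).1, (𝒮.regular U hU w hw.1).2.1, hw.2⟩
  floor U hU w hw := 𝒮.floor U hU w hw.1
  seed := by
    obtain ⟨U, hU, w, hw, hd⟩ := 𝒮.seed
    exact ⟨U, hU, w, hw, hd⟩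

/-- The core has the scheme's scale ratio. [folklore] -/
@[simp] theorem core_lam : 𝒮.core.lam = 𝒮.lam := rfl

/-- The core has the scheme's efficiency floor. [folklore] -/
@[simp] theorem core_eta : 𝒮.core.eta = 𝒮.eta := rfl

/-- The core has the scheme's threshold. [folklore] -/
@[simp] theorem core_UStar : 𝒮.core.UStar = 𝒮.UStar := rfl

/-- The core has the scheme's nest radius. [folklore] -/
@[simp] theorem core_R : 𝒮.core.R = 𝒮.R := rfl

/-- The core has the scheme's floor constant. [folklore] -/
@[simp] theorem core_c : 𝒮.core.c = 𝒮.c := rfl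

/-- The core has the scheme's displacement bound. [folklore] -/
@[simp] theorem core_D : 𝒮.core.D = 𝒮.D := rfl

/-- The core has the scheme's trigger constants. [folklore] -/
@[simp] theorem core_A : 𝒮.core.A = 𝒮.A := rfl

/-- The core has the scheme's e-fold budget. [folklore] -/
@[simp] theorem core_a : 𝒮.core.a = 𝒮.a := rfl

/-- The core has the scheme's clock constant. [folklore] -/
@[simp] theorem core_Cτ : 𝒮.core.Cτ = 𝒮.Cτ := rfl

/-- The core has the scheme's clock exponent. [folklore] -/
@[simp] theorem core_q : 𝒮.core.q = 𝒮.q := rfl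

/-- The core has the scheme's growth factor `(ηλ)^{1/2}`. [folklore] -/
@[simp] theorem core_growth : 𝒮.core.growth = 𝒮.growth := rfl

/-- The core's alphabet is the Clay sub-alphabet of the working alphabet. [folklore] -/
theorem mem_core_F {U : ℝ} {w : Vel} : w ∈ 𝒮.core.F U ↔ w ∈ 𝒮.F U ∧ HasRapidSpatialDecay w :=
  Iff.rfl

/-- A trigger of the scheme is a trigger of its core (same `R`, `A`). [folklore] -/
theorem core_isTrigger_iff {ε δ T : ℝ} {g : ℝ → Vel} :
    𝒮.core.IsTrigger ε δ T g ↔ 𝒮.IsTrigger ε δ T g :=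
  ⟨fun h => ⟨h.smooth, h.off_early, h.off_late, h.off_far, h.small⟩,
    fun h => ⟨h.smooth, h.off_early, h.off_late, h.off_far, h.small⟩⟩

variable {𝒮} in
/-- **A v2 link is a piece of the core** (hand-over into the `H¹` alphabet; forget the membership,
keep the data). [folklore] -/
def Link.toPiece {ν U ε : ℝ} {w : Vel} (L : 𝒮.Link ν U ε w) : 𝒮.core.Piece ν U ε w where
  T := L.T
  δ := L.δ
  g := L.g
  u := L.u
  p := L.p
  U' := L.U'
  w' := L.w'
  x₀ := L.x₀
  δ_pos := L.δ_pos
  two_δ_lt := L.two_δ_lt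
  T_le := L.T_le
  trigger := 𝒮.core_isTrigger_iff.2 L.trigger
  classical := L.classical
  initial := L.initial
  energy := L.energy
  growth_le := L.growth_le
  norm_x₀_le := L.norm_x₀_le
  handover := L.handover

/-- The piece of a link keeps its hand-over state. [folklore] -/
@[simp] theorem Link.toPiece_w' {ν U ε : ℝ} {w : Vel} (L : 𝒮.Link ν U ε w) : L.toPiece.w' = L.w' := rfl

/-- The piece of a link keeps its hand-over amplitude. [folklore] -/
@[simp] theorem Link.toPiece_U' {ν U ε : ℝ} {w : Vel} (L : 𝒮.Link ν U ε w) : L.toPiece.U' = L.U' :=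
  rfl

/-! ## From the physics to a cascade: dependent choice through the `H¹` alphabet -/

/-- **A transferring `H¹` scheme has a cascade** (`ν > 0`): start from the rapidly decaying
IGNITION member that `seed` provides, fire at every level the transfer that `Transfers ν` provides for
the admissible level seed `seedAt ν n U` (`seedAt_pos/_le_one/_admissible` of the core), and continue
from its hand-over state, a member of the `H¹` alphabet one amplitude level up; `regular` supplies
smoothness, incompressibility and `H¹` of every state, `floor` the speed floors, `seed` the rapid
decay of the level-`0` state. [cite: Tao2016AveragedNS, §1.3] -/
theorem nonempty_cascade {ν : ℝ} (hν : 0 < ν) (hT : 𝒮.Transfers ν) :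
    Nonempty (𝒮.core.Cascade ν) := by
  classical
  -- admissible working states
  let X := {q : ℝ × Vel // 𝒮.UStar ≤ q.1 ∧ q.2 ∈ 𝒮.F q.1}
  have key : ∀ (n : ℕ) (q : X), Nonempty (𝒮.Link ν q.1.1 (𝒮.core.seedAt ν n q.1.1) q.1.2) := by
    intro n q
    have hU0 : 0 ≤ q.1.1 := 𝒮.UStar_pos.le.trans q.2.1
    exact 𝒮.step_iff_nonempty_link.1 (hT q.1.1 q.2.1 q.1.2 q.2.2 _ (𝒮.core.seedAt_pos ν n _)
      (𝒮.core.seedAt_le_one hν n hU0) (𝒮.core.seedAt_admissible hν n hU0))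
  let lk : ∀ (n : ℕ) (q : X), 𝒮.Link ν q.1.1 (𝒮.core.seedAt ν n q.1.1) q.1.2 := fun n q =>
    Classical.choice (key n q)
  -- the successor state: the hand-over amplitude and member
  have hU' : ∀ (n : ℕ) (q : X), 𝒮.UStar ≤ (lk n q).U' := fun n q =>
    q.2.1.trans ((le_mul_of_one_le_left (𝒮.UStar_pos.le.trans q.2.1) 𝒮.one_lt_growth.le).trans
      (lk n q).growth_le)
  let nx : ℕ → X → X := fun n q => ⟨((lk n q).U', (lk n q).w'), hU' n q, (lk n q).mem⟩
  obtain ⟨U₀, hU₀, w₀, hw₀, hd₀⟩ := 𝒮.seed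
  let q₀ : X := ⟨(U₀, w₀), hU₀, hw₀⟩
  let st : ℕ → X := fun n => Nat.rec q₀ (fun k q => nx k q) n
  have hst : ∀ n, st (n + 1) = nx n (st n) := fun n => rfl
  have hst0 : st 0 = q₀ := rfl
  have hreg : ∀ n, ContDiff ℝ ∞ (st n).1.2 ∧ NSWave0.IsDivFree (st n).1.2 ∧
      MemLp (st n).1.2 2 volume ∧ MemLp (fderiv ℝ (st n).1.2) 2 volume :=
    fun n => 𝒮.regular _ (st n).2.1 _ (st n).2.2
  exact ⟨{ U := fun n => (st n).1.1
           w := fun n => (st n).1.2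
           link := fun n => (lk n (st n)).toPiece
           UStar_le_zero := hU₀
           U_succ := fun n => by rw [hst n]; rfl
           w_succ := fun n => by rw [hst n]; rfl
           decay_zero := by rw [hst0]; exact hd₀
           smooth := fun n => (hreg n).1
           divFree := fun n => (hreg n).2.1
           h1 := fun n => (hreg n).2.2
           floor := fun n => 𝒮.floor _ (st n).2.1 _ (st n).2.2 }⟩

/-! ## The door closes on (C), with no named fact -/

/-- **CASCADE GLUING through the `H¹` door.** If an `H¹` scheme TRANSFERS at viscosity `ν > 0`,
there is an exact forced Navier–Stokes blow-up of Clay class at viscosity `ν` (`BreakdownWitness ν`):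
the cascade of `nonempty_cascade`, glued by `TriggeredTransferCascadeWitness`. UNCONDITIONAL.
[cite: Tao2016AveragedNS, §1.3] -/
theorem nonempty_breakdownWitness {ν : ℝ} (hν : 0 < ν) (hT : 𝒮.Transfers ν) :
    Nonempty (BreakdownWitness ν) :=
  𝒮.core.nonempty_breakdownWitness_of_cascade hν (𝒮.nonempty_cascade hν hT)

/-- **Door N1-FC v2 closes on Fefferman's (C) modulo its physics ALONE.** An `H¹` scheme that
transfers at one viscosity `ν > 0` gives the breakdown statement `NavierStokesBreakdownR3` (Clay (C),
at every viscosity) — ZERO named facts: the competing global smooth solution is excluded by the tree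
theorem `tao_unconditional_uniqueness_velocity_forced_holds` inside `navierStokesBreakdownR3_of_cascade`.
[cite: FeffermanClay2006, (C)] -/
theorem navierStokesBreakdownR3_of_transfers {ν : ℝ} (hν : 0 < ν) (hT : 𝒮.Transfers ν) :
    Summit.NavierStokesRegularity.NavierStokesRegularity.NavierStokesBreakdownR3 :=
  𝒮.core.navierStokesBreakdownR3_of_cascade hν (𝒮.nonempty_cascade hν hT)

/-- The bounded door v2 closes on (C) as well (forget the ceilings). [cite: FeffermanClay2006, (C)] -/
theorem navierStokesBreakdownR3_of_transfersB {ν : ℝ} (hν : 0 < ν) (hT : 𝒮.TransfersB ν) :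
    Summit.NavierStokesRegularity.NavierStokesRegularity.NavierStokesBreakdownR3 :=
  𝒮.navierStokesBreakdownR3_of_transfers hν hT.transfers

/-- **The existential form a route would carry**: SOME `H¹` scheme transfers at unit viscosity ⇒ (C).
[cite: FeffermanClay2006, (C)] -/
theorem navierStokesBreakdownR3_of_exists_transfers (h : ∃ 𝒮 : TriggerSchemeH1, 𝒮.Transfers 1) :
    Summit.NavierStokesRegularity.NavierStokesRegularity.NavierStokesBreakdownR3 := by
  obtain ⟨𝒮, hT⟩ := h
  exact 𝒮.navierStokesBreakdownR3_of_transfers one_pos hT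

/-- The existential BOUNDED form ⇒ (C). [cite: FeffermanClay2006, (C)] -/
theorem navierStokesBreakdownR3_of_exists_transfersB (h : ∃ 𝒮 : TriggerSchemeH1, 𝒮.TransfersB 1) :
    Summit.NavierStokesRegularity.NavierStokesRegularity.NavierStokesBreakdownR3 := by
  obtain ⟨𝒮, hT⟩ := h
  exact 𝒮.navierStokesBreakdownR3_of_transfersB one_pos hT

/-- At any positive viscosity: SOME `H¹` scheme transfers at SOME `ν > 0` ⇒ (C). [cite: FeffermanClay2006, (C)] -/
theorem navierStokesBreakdownR3_of_exists_transfers_at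
    (h : ∃ ν : ℝ, 0 < ν ∧ ∃ 𝒮 : TriggerSchemeH1, 𝒮.Transfers ν) :
    Summit.NavierStokesRegularity.NavierStokesRegularity.NavierStokesBreakdownR3 := by
  obtain ⟨ν, hν, 𝒮, hT⟩ := h
  exact 𝒮.navierStokesBreakdownR3_of_transfers hν hT

end Summit.NavierStokesRegularity.FluidComputer.TriggeredTransfer.TriggerSchemeH1

end
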